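import Summits.CriticalPhenomena.Ising3DConformalLimit.Theses.LeeYangGap
import Literature.Barriers.CriticalPhenomena.IsingTrivialityFromDimensionFourProofs

/-!
# LeeYangGap — assembly glue (item stmt-CriticalPhenomena-4951)

The chain of route `LeeYangGap` as one implication:
GAP → FirstZeroAntitoneInBeta → MonotonicityTransfer → NewmanFirstZeroBound →
GaussianLimitKillsBlockCoupling → MoebLim → `Ising3DConformalLimit`.

Proof: take the Möbius-covariant non-degenerate limit `(ρ, Δ, S)` from MoebLim; it remains to
show clause (iii) `HasNontrivialU4 S`. If it failed, GaussianLimitKillsBlockCoupling (fed the scale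
covariance contained in Möbius covariance) gives `g_L → 0` for the block Binder coupling
`g_L = (3Σ_L² − ⟨M_L⁴⟩)/Σ_L²`. GAP supplies, frequently in `L`, a zero `θ > 0` of
`⟨cos(θ M_L)⟩_β` at some `β ∈ [0, β_c]` with `θ²Σ_L ≤ C`; MonotonicityTransfer (fed
FirstZeroAntitoneInBeta) moves it to a zero `θ' ∈ (0, θ]` at `β_c`, and NewmanFirstZeroBound gives
`12/θ'⁴ ≤ 3Σ_L² − ⟨M_L⁴⟩`. Since `Σ_L > 0` (`blockVariance_pos`), `g_L ≥ 12/(θ'²Σ_L)² ≥ 12/C²`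
frequently, contradicting `g_L → 0`.
-/

namespace Summit.CriticalPhenomena.Ising3DConformalLimit.Theorems

open Filter Literature.Probability.LatticeModels

/-- **Assembly glue of route LeeYangGap** (item stmt-CriticalPhenomena-4951): the implication
GAP → FirstZeroAntitoneInBeta → MonotonicityTransfer → NewmanFirstZeroBound →
GaussianLimitKillsBlockCoupling → MoebLim → `Ising3DConformalLimit`, proved by pure logic plus
positivity of the critical block variance `Σ_L = ⟨M_L²⟩_{β_c} > 0`: the MoebLim witness supplies
clauses (i)–(ii) of the conjunct, and clause (iii) `U₄ ≢ 0` holds because otherwise the block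
Binder coupling `g_L → 0` (GaussianLimitKillsBlockCoupling), while a near-critical Lee–Yang zero at
the fluctuation scale (GAP), transported to `β_c` (MonotonicityTransfer ∘ FirstZeroAntitoneInBeta)
and fed to Newman's bound `12/θ⁴ ≤ −U₄(M_L)`, forces `g_L ≥ 12/C²` for infinitely many `L`.
[folklore] -/
theorem leeYangGap_assembly_proof :
    Summit.CriticalPhenomena.Ising3DConformalLimit.Theses.LeeYangGap.Assembly := by
  unfold Summit.CriticalPhenomena.Ising3DConformalLimit.Theses.LeeYangGap.Assembly
  intro hGap hAnti hTransfer hNewman hKill hMoeb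
  obtain ⟨ρ, Δ, S, hρ, hΔ, hlim, hnd, hM⟩ := hMoeb
  refine ⟨ρ, Δ, S, hρ, hΔ, hlim, hnd, hM, ?_⟩
  -- clause (iii) by contradiction: suppose U₄ ≡ 0 on non-coincident configurations
  by_contra hU4
  -- notation: Σ_L and ⟨M_L⁴⟩ at β_c
  set V : ℕ → ℝ := fun L => plusExpect 3 (criticalBeta 3) 0
    (fun σ => (∑ x ∈ box 3 L, spinAt x σ) ^ 2) with hV
  set M4 : ℕ → ℝ := fun L => plusExpect 3 (criticalBeta 3) 0
    (fun σ => (∑ x ∈ box 3 L, spinAt x σ) ^ 4) with hM4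
  have hβc : (0 : ℝ) ≤ criticalBeta 3 := criticalBeta_nonneg 3
  -- Σ_L > 0 (Griffiths I in the plus state; the diagonal term at the origin is 1)
  have hVpos : ∀ L, 0 < V L := fun L =>
    Literature.Barriers.CriticalPhenomena.blockVariance_pos (d := 3) hβc L
  -- the Gaussian limit kills the block coupling: g_L → 0
  have hg : Tendsto (fun L : ℕ => (3 * (V L) ^ 2 - M4 L) / (V L) ^ 2) atTop (nhds 0) :=
    hKill ρ Δ S hρ hlim hnd hM.isScaleCovariant hU4
  -- frequently in L: a zero at β_c with θ'²Σ_L ≤ C and Newman's bound, hence g_L ≥ 12 / C²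
  obtain ⟨C, hC⟩ := hGap
  have hfreq : ∃ᶠ L : ℕ in atTop, 0 < C ∧ 12 / C ^ 2 ≤ (3 * (V L) ^ 2 - M4 L) / (V L) ^ 2 := by
    refine hC.mono fun L hL => ?_
    obtain ⟨β, θ, hβ0, hβc', hθ, hθC, hzero⟩ := hL
    -- move the zero to β_c
    obtain ⟨θ', hθ', hθ'θ, hzero'⟩ :=
      hTransfer hAnti L β (criticalBeta 3) θ hβ0 hβc' le_rfl hθ hzero
    -- Newman: 12/θ'^4 ≤ 3Σ_L² − ⟨M_L⁴⟩
    have hN : 12 / θ' ^ 4 ≤ 3 * (V L) ^ 2 - M4 L := hNewman L θ' hθ' hzero'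
    have hVL : 0 < V L := hVpos L
    -- θ'²Σ_L ≤ θ²Σ_L ≤ C
    have hθ'C : θ' ^ 2 * V L ≤ C := by
      have h1 : θ' ^ 2 ≤ θ ^ 2 := by
        exact pow_le_pow_left₀ hθ'.le hθ'θ 2
      calc θ' ^ 2 * V L ≤ θ ^ 2 * V L := by
            exact mul_le_mul_of_nonneg_right h1 hVL.le
        _ ≤ C := hθC
    have hprod_pos : 0 < θ' ^ 2 * V L := mul_pos (pow_pos hθ' 2) hVL
    have hCpos : 0 < C := lt_of_lt_of_le hprod_pos hθ'C
    refine ⟨hCpos, ?_⟩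
    -- 12/C² ≤ 12/(θ'²Σ_L)² = (12/θ'^4)/Σ_L² ≤ (3Σ_L² − M4)/Σ_L²
    have hV2 : 0 < (V L) ^ 2 := pow_pos hVL 2
    have hsq : (θ' ^ 2 * V L) ^ 2 ≤ C ^ 2 := by
      exact pow_le_pow_left₀ hprod_pos.le hθ'C 2
    calc 12 / C ^ 2 ≤ 12 / (θ' ^ 2 * V L) ^ 2 := by
          apply div_le_div_of_nonneg_left (by norm_num) (pow_pos hprod_pos 2) hsq
      _ = (12 / θ' ^ 4) / (V L) ^ 2 := by
          rw [mul_pow, ← pow_mul, div_div]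
      _ ≤ (3 * (V L) ^ 2 - M4 L) / (V L) ^ 2 := by
          exact div_le_div_of_nonneg_right hN hV2.le
  -- C > 0 (from any one of the frequent L), so eventually g_L < 12 / C²
  obtain ⟨L₀, hCpos, -⟩ := hfreq.exists
  have hev : ∀ᶠ L : ℕ in atTop, (3 * (V L) ^ 2 - M4 L) / (V L) ^ 2 < 12 / C ^ 2 :=
    hg (Iio_mem_nhds (by positivity))
  obtain ⟨L, ⟨-, hge⟩, hlt⟩ := (hfreq.and_eventually hev).exists
  exact absurd hge (not_le.mpr hlt)

end Summit.CriticalPhenomena.Ising3DConformalLimit.Theorems
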